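import Mathlib.Analysis.Normed.Module.Convex
import Literature.Analysis.Complex.VitaliConvergence
import Summits.CriticalPhenomena.CardyFormulaZ2.Theses.CardyUSTContinuation
import Summits.CriticalPhenomena.CardyFormulaZ2.Theorems.CardyUSTContinuationVitaliContinuation
import Summits.CriticalPhenomena.CardyFormulaZ2.Theorems.CardyUSTContinuationContinuumFamily

/-!
# Stub `stub_windowGlue` of the line `registered` (skeleton v3) for the crux `Target`
# (stmt-CriticalPhenomena-6046, route `CardyUSTContinuation`) — rigidity of the conjunction

`Target` is the conjunction `SmallFugacityLimit ∧ UniformAnalyticExtension` (X_S ∧ X_A) of the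
two interval cruxes of the route.  This file proves what only the conjunction sees: under the
Lee–Yang crux X_A, the small-fugacity crux X_S is RIGID in its window.

* `tendsto_thickening_of_tendsto_window` — Vitali–Porter on the convex `ρ`-thickening `S` of the
  complex segment `[t₁, 1]`: a family `g δ`, holomorphic and bounded by one `M` on `S` for all
  small `δ > 0`, which converges on a real window `(a, b) ⊆ [t₁, 1]` to a function `G` holomorphic
  on `S`, converges to `G` at EVERY point of `S` (the landed `vitaliContinuation_proof` is the
  special case "window `(t₁, t₀)`, point `1`").
* `hasCrossingLimit_of_window` — abstract core, one conformal rectangle: given (A) δ-uniform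
  bounded analytic extensions of `t ↦ u t δ` near every `[t₁, 1]`, (C₂) analytic continuation of
  each `U · η` near `[0, 1]`, and crossing limits `u t · → U t` on SOME window `(a, b) ⊆ (0, 1]`,
  the crossing limit `u t · → U t` holds for EVERY `t ∈ (0, 1]`.
* `cardyUST_smallFugacityLimit_of_window` — hence `UniformAnalyticExtension` and the WINDOW form of X_S
  (for every `R`, convergence to the Miller–Werner law on some window `(a, b)`, `0 < a < b ≤ 1`)
  already give `SmallFugacityLimit` (with `t₀ = 1`); the window form is trivially implied by
  `SmallFugacityLimit` (`cardyUST_window_of_smallFugacityLimit`), so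
  `cardyUST_target_iff_window : Target ↔ UniformAnalyticExtension ∧ (window form)`.
* `cardyUST_target_allFugacity` — and `Target` pins the Miller–Werner law in joint wiring for EVERY
  `q = t² ∈ (0, 1]`: `u_R(t, δ) → U(t, η)` for all `t ∈ (0, 1]` and all `R` (so the route's
  CHEAPEST FALSIFIER (3) at any single `t ∈ (0, 1]` is a test of `Target` itself).
* `hasCrossingLimit_cardy_of_window` — sharper assembly core: Cardy's formula for `R` already
  follows from bounded analytic extensions near ONE segment `[t₁, 1]`, crossing limits on ONE
  window `(a, b) ⊆ [t₁, 1]`, the endpoint identification at `t = 1` and the continuum facts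
  (the route's `Target` asks for X_A at every `t₁` and X_S on `(0, t₀)`).
* `…Cruxes.Target.CardyUSTContinuationBirth.stub_windowGlue` — the registered stub G of skeleton
  v3 (same name, namespace and signature as registered; the window form is spelled there with the
  shared `let`s CHARACTERISED — `∀ Z U uJ, (Z = …) → (U = …) → (uJ = …) → …` — instead of bound).

Ingredients: the landed `continuumFamily_proof` (stmt-6052) and
`Literature.Analysis.Complex.exists_tendstoLocallyUniformlyOn_of_frequently_tendsto` (Vitali).
-/

namespace Summit.CriticalPhenomena.CardyFormulaZ2.Theorems

open Filter Set Metric Topology Complex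
open Literature.Probability.RandomPlanarGeometry Literature.Probability.Percolation
open Summit.CriticalPhenomena.CardyFormulaZ2.Theses.CardyUSTContinuation

/-- **Vitali–Porter on a thickened segment, window form.** If `g δ` is, for all small `δ > 0`,
holomorphic on the `ρ`-neighbourhood `S` of `[t₁, 1] ⊆ ℂ` and bounded there by `M`, `G` is
holomorphic on `S`, and `g δ t → G t` as `δ → 0⁺` for every real `t` of a window `(a, b)` with
`t₁ ≤ a < b ≤ 1`, then `g δ w → G w` as `δ → 0⁺` for every `w ∈ S` (Montel + identity theorem on
the connected open set `S`). -/
theorem tendsto_thickening_of_tendsto_window {t₁ a b ρ M : ℝ} (ht₁a : t₁ ≤ a) (hab : a < b)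
    (hb1 : b ≤ 1) (hρ : 0 < ρ) (g : ℝ → ℂ → ℂ) (G : ℂ → ℂ)
    (hg : ∀ᶠ δ in 𝓝[>] (0:ℝ),
      DifferentiableOn ℂ (g δ) (thickening ρ (((↑) : ℝ → ℂ) '' Icc t₁ 1)) ∧
        ∀ z ∈ thickening ρ (((↑) : ℝ → ℂ) '' Icc t₁ 1), ‖g δ z‖ ≤ M)
    (hG : DifferentiableOn ℂ G (thickening ρ (((↑) : ℝ → ℂ) '' Icc t₁ 1)))
    (hconv : ∀ t ∈ Ioo a b, Tendsto (fun δ => g δ t) (𝓝[>] 0) (𝓝 (G t))) :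
    ∀ w ∈ thickening ρ (((↑) : ℝ → ℂ) '' Icc t₁ 1),
      Tendsto (fun δ => g δ w) (𝓝[>] 0) (𝓝 (G w)) := by
  intro w hw
  set K : Set ℂ := ((↑) : ℝ → ℂ) '' Icc t₁ 1 with hK
  set S : Set ℂ := thickening ρ K with hS
  have hSo : IsOpen S := isOpen_thickening
  have hSc : IsPreconnected S := ((convex_ofReal_image_Icc t₁ 1).thickening ρ).isPreconnected
  have hKS : K ⊆ S := self_subset_thickening hρ K
  have hmemS : ∀ t ∈ Icc t₁ 1, (t : ℂ) ∈ S := fun t ht => hKS ⟨t, ht, rfl⟩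
  -- reduce to sequences `δ n → 0⁺`
  rw [tendsto_iff_seq_tendsto]
  intro δ hδ
  classical
  -- the good indices: `g (δ n)` holomorphic on `S` and bounded by `M`
  set P : ℝ → Prop := fun d => DifferentiableOn ℂ (g d) S ∧ ∀ z ∈ S, ‖g d z‖ ≤ M with hP
  have hPev : ∀ᶠ n in atTop, P (δ n) := hδ.eventually hg
  -- the repaired sequence
  set F : ℕ → ℂ → ℂ := fun n => if P (δ n) then g (δ n) else fun _ => 0 with hF
  have hFeq : ∀ᶠ n in atTop, F n = g (δ n) := by
    filter_upwards [hPev] with n hn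
    simp only [hF, if_pos hn]
  have hFd : ∀ n, DifferentiableOn ℂ (F n) S := by
    intro n
    by_cases hn : P (δ n)
    · simp only [hF, if_pos hn]; exact hn.1
    · simp only [hF, if_neg hn]; exact differentiableOn_const 0
  have hFb : ∀ n, ∀ z ∈ S, ‖F n z‖ ≤ max M 0 := by
    intro n z hz
    by_cases hn : P (δ n)
    · simp only [hF, if_pos hn]; exact (hn.2 z hz).trans (le_max_left _ _)
    · simp only [hF, if_neg hn, norm_zero]; exact le_max_right _ _
  have hbd : ∀ c ∈ S, ∃ M' : ℝ, ∃ r > 0, ∀ n, ∀ z ∈ ball c r ∩ S, ‖F n z‖ ≤ M' :=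
    fun c _ => ⟨max M 0, 1, one_pos, fun n z hz => hFb n z hz.2⟩
  -- pointwise convergence on the real window `(a, b)`
  have hpt : ∀ t ∈ Ioo a b, Tendsto (fun n => F n t) atTop (𝓝 (G t)) := by
    intro t ht
    have h1 : Tendsto (fun n => g (δ n) t) atTop (𝓝 (G t)) := (hconv t ht).comp hδ
    refine h1.congr' ?_
    filter_upwards [hFeq] with n hn
    rw [hn]
  -- the accumulation point `c`, midpoint of the window
  set c : ℝ := (a + b) / 2 with hc
  have hac : a < c := by rw [hc]; linarith
  have hcb : c < b := by rw [hc]; linarith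
  have hcS : (c : ℂ) ∈ S := hmemS c ⟨ht₁a.trans hac.le, hcb.le.trans hb1⟩
  have hnear : ∀ᶠ s : ℝ in 𝓝[>] c, s ∈ Ioo a b :=
    mem_nhdsWithin_of_mem_nhds (isOpen_Ioo.mem_nhds ⟨hac, hcb⟩)
  have hnear' : ∀ᶠ s : ℝ in 𝓝[>] c, s ∈ Ioo a b ∧ (s : ℂ) ∈ S := by
    filter_upwards [hnear] with s hs
    exact ⟨hs, hmemS s ⟨ht₁a.trans hs.1.le, hs.2.le.trans hb1⟩⟩
  -- `ℝ → ℂ` maps the right punctured neighbourhoods of `c` into the punctured ones of `↑c`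
  have htend : Tendsto (fun s : ℝ => (s : ℂ)) (𝓝[>] c) (𝓝[≠] (c : ℂ)) := by
    have h1 : Tendsto (fun s : ℝ => (s : ℂ)) (𝓝[>] c) (𝓝[{(c : ℂ)}ᶜ] (c : ℂ)) :=
      continuous_ofReal.continuousWithinAt.tendsto_nhdsWithin fun s hs =>
        fun h => (ne_of_gt hs) (ofReal_injective h)
    simpa using h1
  have hfreq : ∃ᶠ z in 𝓝[≠] (c : ℂ), ∃ e : ℂ, Tendsto (fun n => F n z) atTop (𝓝 e) := by
    have hev : ∀ᶠ s : ℝ in 𝓝[>] c, ∃ e : ℂ, Tendsto (fun n => F n s) atTop (𝓝 e) := by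
      filter_upwards [hnear'] with s hs using ⟨G s, hpt s hs.1⟩
    exact htend.frequently hev.frequently
  -- Vitali's convergence theorem
  obtain ⟨f, hf, hlim⟩ :=
    Literature.Analysis.Complex.exists_tendstoLocallyUniformlyOn_of_frequently_tendsto hSo hSc
      hFd hbd hcS hfreq
  -- the limit is `G` (identity theorem)
  have hfG : EqOn f G S := by
    have hev : ∀ᶠ s : ℝ in 𝓝[>] c, f s = G s := by
      filter_upwards [hnear'] with s hs
      exact tendsto_nhds_unique (hlim.tendsto_at hs.2) (hpt s hs.1)
    exact (hf.analyticOnNhd hSo).eqOn_of_preconnected_of_frequently_eq (hG.analyticOnNhd hSo) hSc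
      hcS (htend.frequently hev.frequently)
  -- conclude at `w ∈ S`
  have hFw : Tendsto (fun n => F n w) atTop (𝓝 (G w)) := by
    rw [← hfG hw]
    exact hlim.tendsto_at hw
  refine hFw.congr' ?_
  filter_upwards [hFeq] with n hn
  simp [hn]

/-- **Window rigidity, one conformal rectangle.** For any continuum family `U t η` and lattice
family `u t δ` attached to `R`: if (A) for every `t₁ ∈ (0,1)`, eventually in `δ → 0⁺`,
`t ↦ u t δ` on `[t₁, 1]` extends to a function analytic and bounded by one `M` on one complex
`ρ`-neighbourhood of `[t₁, 1]`; (C₂) each `U · η`, `η ∈ (0,1)`, extends analytically near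
`[0, 1] ⊆ ℂ`; and (W) `u t ·` has crossing limit `U t` for every `t` of SOME window `(a, b)` with
`0 < a < b ≤ 1` — then `u t ·` has crossing limit `U t` for EVERY `t ∈ (0, 1]`. -/
theorem hasCrossingLimit_of_window (U : ℝ → ℝ → ℝ) (u : ℝ → ℝ → ℝ) (R : ConformalRectangle)
    (hA : ∀ t₁ ∈ Set.Ioo (0:ℝ) 1, ∃ ρ > (0:ℝ), ∃ M : ℝ,
      ∀ᶠ δ in 𝓝[>] (0:ℝ), ∃ g : ℂ → ℂ,
        DifferentiableOn ℂ g (Metric.thickening ρ (((↑) : ℝ → ℂ) '' Set.Icc t₁ 1)) ∧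
        (∀ z ∈ Metric.thickening ρ (((↑) : ℝ → ℂ) '' Set.Icc t₁ 1), ‖g z‖ ≤ M) ∧
        ∀ t ∈ Set.Icc t₁ 1, g t = u t δ)
    (hC₂ : ∀ η ∈ Set.Ioo (0:ℝ) 1, ∃ ρ > (0:ℝ), ∃ Uc : ℂ → ℂ,
      DifferentiableOn ℂ Uc (Metric.thickening ρ (((↑) : ℝ → ℂ) '' Set.Icc (0:ℝ) 1)) ∧
        ∀ t ∈ Set.Icc (0:ℝ) 1, Uc t = U t η)
    {a b : ℝ} (ha : 0 < a) (hab : a < b) (hb : b ≤ 1)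
    (hW : ∀ t ∈ Set.Ioo a b, R.HasCrossingLimit (fun δ => u t δ) (U t)) :
    ∀ t ∈ Set.Ioc (0:ℝ) 1, R.HasCrossingLimit (fun δ => u t δ) (U t) := by
  intro t ht φ x hφx
  have hη01 : crossRatio x ∈ Set.Ioo (0:ℝ) 1 :=
    ConformalRectangle.crossRatio_mem_Ioo_of_isUniformizing hφx
  -- the segment `[t₁, 1]` with `t₁ := min a t / 2`, containing the window and the point `t`
  set t₁ : ℝ := min a t / 2 with ht₁def
  have hmin : 0 < min a t := lt_min ha ht.1
  have ht₁0 : 0 < t₁ := by rw [ht₁def]; positivity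
  have ht₁a : t₁ ≤ a := by
    rw [ht₁def]; linarith [min_le_left a t]
  have ht₁t : t₁ ≤ t := by
    rw [ht₁def]; linarith [min_le_right a t]
  have ht₁1 : t₁ < 1 := lt_of_le_of_lt ht₁a (hab.trans_le hb)
  obtain ⟨ρ, hρ, M, hAev⟩ := hA t₁ ⟨ht₁0, ht₁1⟩
  obtain ⟨ρ', hρ', Uc, hUc, hUcU⟩ := hC₂ _ hη01
  -- the two complex neighbourhoods and their common shrinking
  set K : Set ℂ := ((↑) : ℝ → ℂ) '' Set.Icc t₁ 1 with hK
  set ρ₀ : ℝ := min ρ ρ' with hρ₀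
  have hρ₀0 : 0 < ρ₀ := lt_min hρ hρ'
  have hsub₁ : Metric.thickening ρ₀ K ⊆ Metric.thickening ρ K :=
    Metric.thickening_mono (min_le_left _ _) _
  have hsub₂ : Metric.thickening ρ₀ K ⊆
      Metric.thickening ρ' (((↑) : ℝ → ℂ) '' Set.Icc (0:ℝ) 1) :=
    (Metric.thickening_mono (min_le_right _ _) _).trans
      (Metric.thickening_subset_of_subset _ (Set.image_mono (Set.Icc_subset_Icc_left ht₁0.le)))
  -- choose the analytic extensions `g δ` (arbitrary where none exists)
  obtain ⟨g, hgP⟩ : ∃ g : ℝ → ℂ → ℂ, ∀ᶠ δ in 𝓝[>] (0:ℝ),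
      DifferentiableOn ℂ (g δ) (Metric.thickening ρ K) ∧
      (∀ z ∈ Metric.thickening ρ K, ‖g δ z‖ ≤ M) ∧
      ∀ s ∈ Set.Icc t₁ 1, g δ s = u s δ :=
    ⟨fun δ => Classical.epsilon (fun g : ℂ → ℂ =>
        DifferentiableOn ℂ g (Metric.thickening ρ K) ∧
        (∀ z ∈ Metric.thickening ρ K, ‖g z‖ ≤ M) ∧
        ∀ s ∈ Set.Icc t₁ 1, g s = u s δ),
      hAev.mono fun δ hδ => Classical.epsilon_spec hδ⟩
  -- the point `t` lies in the (shrunk) neighbourhood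
  have htK : (t : ℂ) ∈ Metric.thickening ρ₀ K :=
    Metric.self_subset_thickening hρ₀0 K ⟨t, ⟨ht₁t, ht.2⟩, rfl⟩
  -- Vitali propagation from the window `(a, b)` to the point `t`
  have hVres : Tendsto (fun δ => g δ t) (𝓝[>] 0) (𝓝 (Uc t)) := by
    refine tendsto_thickening_of_tendsto_window (M := M) ht₁a hab hb hρ₀0 g Uc ?_ (hUc.mono hsub₂)
      ?_ (t : ℂ) htK
    · filter_upwards [hgP] with δ hδ
      exact ⟨hδ.1.mono hsub₁, fun z hz => hδ.2.1 z (hsub₁ hz)⟩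
    · intro s hs
      have hsIcc : s ∈ Set.Icc t₁ 1 := ⟨ht₁a.trans hs.1.le, hs.2.le.trans hb⟩
      have hs01 : s ∈ Set.Icc (0:ℝ) 1 := ⟨(ha.trans hs.1).le, hsIcc.2⟩
      have hlimC : Tendsto (fun δ => ((u s δ : ℝ) : ℂ)) (𝓝[>] 0)
          (𝓝 ((U s (crossRatio x) : ℝ) : ℂ)) :=
        (Complex.continuous_ofReal.tendsto _).comp (hW s hs φ x hφx)
      rw [hUcU s hs01]
      refine hlimC.congr' ?_
      filter_upwards [hgP] with δ hδ
      exact (hδ.2.2 s hsIcc).symm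
  -- read off the value at `t` and take real parts
  have htC : Uc t = ((U t (crossRatio x) : ℝ) : ℂ) := hUcU t ⟨ht.1.le, ht.2⟩
  have hgt : (fun δ => g δ t) =ᶠ[𝓝[>] (0:ℝ)] fun δ => ((u t δ : ℝ) : ℂ) := by
    filter_upwards [hgP] with δ hδ
    exact hδ.2.2 t ⟨ht₁t, ht.2⟩
  have hC : Tendsto (fun δ => ((u t δ : ℝ) : ℂ)) (𝓝[>] 0)
      (𝓝 ((U t (crossRatio x) : ℝ) : ℂ)) := by
    rw [← htC]
    exact hVres.congr' hgt
  have hR := (Complex.continuous_re.tendsto _).comp hC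
  simp only [Function.comp_def, Complex.ofReal_re] at hR
  exact hR

/-- **Window form of the small-fugacity crux suffices, given the Lee–Yang crux.**
`UniformAnalyticExtension` together with convergence of the jointly-wired self-dual FK crossing
probabilities `u_R(t, δ)` to the Miller–Werner law `U(t, ·)` on SOME window `(a, b)`,
`0 < a < b ≤ 1`, for every conformal rectangle `R`, gives `SmallFugacityLimit` (indeed with
`t₀ = 1`).  The analytic continuation of `U(·, η)` near `[0, 1]` is the landed
`continuumFamily_proof` (stmt-6052). -/
theorem cardyUST_smallFugacityLimit_of_window (hA : UniformAnalyticExtension)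
    (hW : let Z : ℝ → ℝ → ℝ := fun u x => x ^ (u / 2) * (1 - x) ^ (1 - 3 * u / 2) * ₂F₁ u (1 - u) (2 * u) x; let U : ℝ → ℝ → ℝ := fun t η => t * Z (Real.arccos (-(t / 2)) / Real.pi) η / (Z (Real.arccos (-(t / 2)) / Real.pi) (1 - η) + t * Z (Real.arccos (-(t / 2)) / Real.pi) η); let uJ : Literature.Probability.RandomPlanarGeometry.ConformalRectangle → ℝ → ℝ → ℝ := fun R t δ => if h : 0 < δ then (@Literature.Probability.LatticeModels.fkDomainMeasure R.carrier δ (t / (1 + t)) (t ^ 2) (R.arc 0 ∪ R.arc 2) (Literature.Probability.LatticeModels.meshDomain_finite R.isBounded h).fintype).real (Literature.Probability.Percolation.discreteCrossing R.carrier δ (R.arc 0) (R.arc 2)) else 0; ∀ R : Literature.Probability.RandomPlanarGeometry.ConformalRectangle, ∃ a b : ℝ, 0 < a ∧ a < b ∧ b ≤ 1 ∧ ∀ t ∈ Set.Ioo a b, R.HasCrossingLimit (fun δ => uJ R t δ) (U t)) :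
    SmallFugacityLimit := by
  have hC := continuumFamily_proof
  unfold ContinuumFamily at hC
  unfold UniformAnalyticExtension at hA
  unfold SmallFugacityLimit
  intro Z U uJ R
  obtain ⟨a, b, ha, hab, hb, hWR⟩ := hW R
  refine ⟨1, one_pos, fun t ht => ?_⟩
  exact hasCrossingLimit_of_window _ _ R (hA R) hC.2 ha hab hb hWR t ⟨ht.1, ht.2.le⟩

/-- Conversely (trivially), `SmallFugacityLimit` gives the window form: take the window
`(t₀'/4, t₀'/2)` with `t₀' := min t₀ 1`. -/
theorem cardyUST_window_of_smallFugacityLimit (hS : SmallFugacityLimit) :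
    let Z : ℝ → ℝ → ℝ := fun u x => x ^ (u / 2) * (1 - x) ^ (1 - 3 * u / 2) * ₂F₁ u (1 - u) (2 * u) x; let U : ℝ → ℝ → ℝ := fun t η => t * Z (Real.arccos (-(t / 2)) / Real.pi) η / (Z (Real.arccos (-(t / 2)) / Real.pi) (1 - η) + t * Z (Real.arccos (-(t / 2)) / Real.pi) η); let uJ : Literature.Probability.RandomPlanarGeometry.ConformalRectangle → ℝ → ℝ → ℝ := fun R t δ => if h : 0 < δ then (@Literature.Probability.LatticeModels.fkDomainMeasure R.carrier δ (t / (1 + t)) (t ^ 2) (R.arc 0 ∪ R.arc 2) (Literature.Probability.LatticeModels.meshDomain_finite R.isBounded h).fintype).real (Literature.Probability.Percolation.discreteCrossing R.carrier δ (R.arc 0) (R.arc 2)) else 0; ∀ R : Literature.Probability.RandomPlanarGeometry.ConformalRectangle, ∃ a b : ℝ, 0 < a ∧ a < b ∧ b ≤ 1 ∧ ∀ t ∈ Set.Ioo a b, R.HasCrossingLimit (fun δ => uJ R t δ) (U t) := by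
  unfold SmallFugacityLimit at hS
  intro Z U uJ R
  obtain ⟨t₀, ht₀, hSR⟩ := hS R
  have hm : 0 < min t₀ 1 := lt_min ht₀ one_pos
  refine ⟨min t₀ 1 / 4, min t₀ 1 / 2, by positivity, by linarith, by linarith [min_le_right t₀ 1],
    fun t ht => hSR t ⟨lt_trans (by positivity) ht.1, ?_⟩⟩
  linarith [ht.2, min_le_left t₀ 1]

/-- **Normal form of the crux.** `Target ↔ UniformAnalyticExtension ∧ (window form of X_S)`:
given the Lee–Yang crux, the small-fugacity crux is needed only on SOME window `(a, b) ⊆ (0, 1]`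
per conformal rectangle — not on an interval abutting the (marginal) tree point `t = 0`. -/
theorem cardyUST_target_iff_window :
    Target ↔ (UniformAnalyticExtension ∧
      (let Z : ℝ → ℝ → ℝ := fun u x => x ^ (u / 2) * (1 - x) ^ (1 - 3 * u / 2) * ₂F₁ u (1 - u) (2 * u) x; let U : ℝ → ℝ → ℝ := fun t η => t * Z (Real.arccos (-(t / 2)) / Real.pi) η / (Z (Real.arccos (-(t / 2)) / Real.pi) (1 - η) + t * Z (Real.arccos (-(t / 2)) / Real.pi) η); let uJ : Literature.Probability.RandomPlanarGeometry.ConformalRectangle → ℝ → ℝ → ℝ := fun R t δ => if h : 0 < δ then (@Literature.Probability.LatticeModels.fkDomainMeasure R.carrier δ (t / (1 + t)) (t ^ 2) (R.arc 0 ∪ R.arc 2) (Literature.Probability.LatticeModels.meshDomain_finite R.isBounded h).fintype).real (Literature.Probability.Percolation.discreteCrossing R.carrier δ (R.arc 0) (R.arc 2)) else 0; ∀ R : Literature.Probability.RandomPlanarGeometry.ConformalRectangle, ∃ a b : ℝ, 0 < a ∧ a < b ∧ b ≤ 1 ∧ ∀ t ∈ Set.Ioo a b, R.HasCrossingLimit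 (fun δ => uJ R t δ) (U t))) := by
  constructor
  · intro hT
    have hS : SmallFugacityLimit := hT.1
    exact ⟨hT.2, cardyUST_window_of_smallFugacityLimit hS⟩
  · rintro ⟨hA, hW⟩
    have hS : SmallFugacityLimit := cardyUST_smallFugacityLimit_of_window hA hW
    unfold SmallFugacityLimit at hS
    unfold UniformAnalyticExtension at hA
    exact ⟨hS, hA⟩

/-- **`Target` pins the Miller–Werner law for every fugacity `t ∈ (0, 1]`.** Under the crux, the
jointly-wired self-dual FK(`q = t²`) crossing probabilities `u_R(t, δ)` have crossing limit
`U(t, ·)` for EVERY `t ∈ (0, 1]` and every conformal rectangle `R` — so a value test of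
`u_R(t, δ)` against `U(t, η)` at any single `t ∈ (0, 1]` (the route's CHEAPEST FALSIFIER (3)) is
a test of `Target` itself. -/
theorem cardyUST_target_allFugacity (hT : Target) :
    let Z : ℝ → ℝ → ℝ := fun u x => x ^ (u / 2) * (1 - x) ^ (1 - 3 * u / 2) * ₂F₁ u (1 - u) (2 * u) x; let U : ℝ → ℝ → ℝ := fun t η => t * Z (Real.arccos (-(t / 2)) / Real.pi) η / (Z (Real.arccos (-(t / 2)) / Real.pi) (1 - η) + t * Z (Real.arccos (-(t / 2)) / Real.pi) η); let uJ : Literature.Probability.RandomPlanarGeometry.ConformalRectangle → ℝ → ℝ → ℝ := fun R t δ => if h : 0 < δ then (@Literature.Probability.LatticeModels.fkDomainMeasure R.carrier δ (t / (1 + t)) (t ^ 2) (R.arc 0 ∪ R.arc 2) (Literature.Probability.LatticeModels.meshDomain_finite R.isBounded h).fintype).real (Literature.Probability.Percolation.discreteCrossing R.carrier δ (R.arc 0) (R.arc 2)) else 0; ∀ R : Literature.Probability.RandomPlanarGeometry.ConformalRectangle, ∀ t ∈ Set.Ioc (0:ℝ) 1, R.HasCrossingLimit (fun δ => uJ R t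 δ) (U t) := by
  have hC := continuumFamily_proof
  unfold ContinuumFamily at hC
  have hS : SmallFugacityLimit := hT.1
  have hA : UniformAnalyticExtension := hT.2
  have hW := cardyUST_window_of_smallFugacityLimit hS
  unfold UniformAnalyticExtension at hA
  intro Z U uJ R
  obtain ⟨a, b, ha, hab, hb, hWR⟩ := hW R
  exact hasCrossingLimit_of_window _ _ R (hA R) hC.2 ha hab hb hWR

/-- **Sharper assembly core (window form).** For one conformal rectangle `R`: bounded analytic
extensions of `t ↦ u t δ` near ONE segment `[t₁, 1]` (eventually in `δ`), crossing limits
`u t · → U t` on ONE window `(a, b) ⊆ [t₁, 1]`, the endpoint identification `u 1 δ =` bond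
crossing probability, `U 1 = cardyFunction` and analytic continuation of `U · η` near `[0,1]`
already give Cardy's formula for `R`. -/
theorem hasCrossingLimit_cardy_of_window (U : ℝ → ℝ → ℝ) (u : ℝ → ℝ → ℝ) (R : ConformalRectangle)
    {t₁ a b : ℝ} (ht₁ : 0 < t₁) (ht₁a : t₁ ≤ a) (hab : a < b) (hb : b ≤ 1)
    (hA₁ : ∃ ρ > (0:ℝ), ∃ M : ℝ, ∀ᶠ δ in 𝓝[>] (0:ℝ), ∃ g : ℂ → ℂ,
        DifferentiableOn ℂ g (Metric.thickening ρ (((↑) : ℝ → ℂ) '' Set.Icc t₁ 1)) ∧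
        (∀ z ∈ Metric.thickening ρ (((↑) : ℝ → ℂ) '' Set.Icc t₁ 1), ‖g z‖ ≤ M) ∧
        ∀ t ∈ Set.Icc t₁ 1, g t = u t δ)
    (hW : ∀ t ∈ Set.Ioo a b, R.HasCrossingLimit (fun δ => u t δ) (U t))
    (hB : ∀ δ : ℝ, 0 < δ → u 1 δ = bondDomainCrossingProb R δ)
    (hC₁ : ∀ η ∈ Set.Ioo (0:ℝ) 1, U 1 η = Literature.Probability.RandomPlanarGeometry.cardyFunction η)
    (hC₂ : ∀ η ∈ Set.Ioo (0:ℝ) 1, ∃ ρ > (0:ℝ), ∃ Uc : ℂ → ℂ,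
      DifferentiableOn ℂ Uc (Metric.thickening ρ (((↑) : ℝ → ℂ) '' Set.Icc (0:ℝ) 1)) ∧
        ∀ t ∈ Set.Icc (0:ℝ) 1, Uc t = U t η) :
    R.HasCrossingLimit (bondDomainCrossingProb R) Literature.Probability.RandomPlanarGeometry.cardyFunction := by
  intro φ x hφx
  have hη01 : crossRatio x ∈ Set.Ioo (0:ℝ) 1 :=
    ConformalRectangle.crossRatio_mem_Ioo_of_isUniformizing hφx
  have ht₁1 : t₁ < 1 := lt_of_le_of_lt ht₁a (hab.trans_le hb)
  obtain ⟨ρ, hρ, M, hAev⟩ := hA₁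
  obtain ⟨ρ', hρ', Uc, hUc, hUcU⟩ := hC₂ _ hη01
  set K : Set ℂ := ((↑) : ℝ → ℂ) '' Set.Icc t₁ 1 with hK
  set ρ₀ : ℝ := min ρ ρ' with hρ₀
  have hρ₀0 : 0 < ρ₀ := lt_min hρ hρ'
  have hsub₁ : Metric.thickening ρ₀ K ⊆ Metric.thickening ρ K :=
    Metric.thickening_mono (min_le_left _ _) _
  have hsub₂ : Metric.thickening ρ₀ K ⊆
      Metric.thickening ρ' (((↑) : ℝ → ℂ) '' Set.Icc (0:ℝ) 1) :=
    (Metric.thickening_mono (min_le_right _ _) _).trans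
      (Metric.thickening_subset_of_subset _ (Set.image_mono (Set.Icc_subset_Icc_left ht₁.le)))
  obtain ⟨g, hgP⟩ : ∃ g : ℝ → ℂ → ℂ, ∀ᶠ δ in 𝓝[>] (0:ℝ),
      DifferentiableOn ℂ (g δ) (Metric.thickening ρ K) ∧
      (∀ z ∈ Metric.thickening ρ K, ‖g δ z‖ ≤ M) ∧
      ∀ s ∈ Set.Icc t₁ 1, g δ s = u s δ :=
    ⟨fun δ => Classical.epsilon (fun g : ℂ → ℂ =>
        DifferentiableOn ℂ g (Metric.thickening ρ K) ∧
        (∀ z ∈ Metric.thickening ρ K, ‖g z‖ ≤ M) ∧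
        ∀ s ∈ Set.Icc t₁ 1, g s = u s δ),
      hAev.mono fun δ hδ => Classical.epsilon_spec hδ⟩
  have h1K : (1 : ℂ) ∈ Metric.thickening ρ₀ K :=
    Metric.self_subset_thickening hρ₀0 K ⟨1, ⟨ht₁1.le, le_rfl⟩, by simp⟩
  have hVres : Tendsto (fun δ => g δ 1) (𝓝[>] 0) (𝓝 (Uc 1)) := by
    refine tendsto_thickening_of_tendsto_window (M := M) ht₁a hab hb hρ₀0 g Uc ?_ (hUc.mono hsub₂)
      ?_ (1 : ℂ) h1K
    · filter_upwards [hgP] with δ hδ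
      exact ⟨hδ.1.mono hsub₁, fun z hz => hδ.2.1 z (hsub₁ hz)⟩
    · intro s hs
      have hsIcc : s ∈ Set.Icc t₁ 1 := ⟨ht₁a.trans hs.1.le, hs.2.le.trans hb⟩
      have hs01 : s ∈ Set.Icc (0:ℝ) 1 := ⟨(ht₁.trans_le (ht₁a.trans hs.1.le)).le, hsIcc.2⟩
      have hlimC : Tendsto (fun δ => ((u s δ : ℝ) : ℂ)) (𝓝[>] 0)
          (𝓝 ((U s (crossRatio x) : ℝ) : ℂ)) :=
        (Complex.continuous_ofReal.tendsto _).comp (hW s hs φ x hφx)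
      rw [hUcU s hs01]
      refine hlimC.congr' ?_
      filter_upwards [hgP] with δ hδ
      exact (hδ.2.2 s hsIcc).symm
  have h1C : Uc 1 = ((U 1 (crossRatio x) : ℝ) : ℂ) := by
    simpa using hUcU 1 ⟨zero_le_one, le_rfl⟩
  have hg1 : (fun δ => g δ 1) =ᶠ[𝓝[>] (0:ℝ)] fun δ => ((u 1 δ : ℝ) : ℂ) := by
    filter_upwards [hgP] with δ hδ
    simpa using hδ.2.2 1 ⟨ht₁1.le, le_rfl⟩
  have hC : Tendsto (fun δ => ((u 1 δ : ℝ) : ℂ)) (𝓝[>] 0)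
      (𝓝 ((U 1 (crossRatio x) : ℝ) : ℂ)) := by
    rw [← h1C]
    exact hVres.congr' hg1
  have hR := (Complex.continuous_re.tendsto _).comp hC
  simp only [Function.comp_def, Complex.ofReal_re] at hR
  have hB' : (fun δ => u 1 δ) =ᶠ[𝓝[>] (0:ℝ)] bondDomainCrossingProb R := by
    filter_upwards [self_mem_nhdsWithin] with δ hδ using hB δ (Set.mem_Ioi.1 hδ)
  rw [← hC₁ _ hη01]
  exact hR.congr' hB'

end Summit.CriticalPhenomena.CardyFormulaZ2.Theorems

/-! ### The registered stub G of skeleton v3 (crux `Target`, stmt-CriticalPhenomena-6046) -/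

namespace Summit.CriticalPhenomena.CardyFormulaZ2.Cruxes.Target.CardyUSTContinuationBirth

open Summit.CriticalPhenomena.CardyFormulaZ2.Theorems
open Summit.CriticalPhenomena.CardyFormulaZ2.Theses.CardyUSTContinuation

/-- **stub_windowGlue** (registered stub G of skeleton v3 for the crux `Target`): the Lee–Yang
crux `UniformAnalyticExtension` and the WINDOW form of the small-fugacity crux (for every
conformal rectangle some window `(a, b)`, `0 < a < b ≤ 1`, of convergence of the jointly-wired
self-dual FK crossing probabilities to the Miller–Werner law; the route's `let`s `Z, U, uJ` are
characterised by equations rather than bound) give `SmallFugacityLimit`. -/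
theorem stub_windowGlue :
    Summit.CriticalPhenomena.CardyFormulaZ2.Theses.CardyUSTContinuation.UniformAnalyticExtension → (∀ (Z U : ℝ → ℝ → ℝ) (uJ : Literature.Probability.RandomPlanarGeometry.ConformalRectangle → ℝ → ℝ → ℝ), (∀ u x, Z u x = x ^ (u / 2) * (1 - x) ^ (1 - 3 * u / 2) * ₂F₁ u (1 - u) (2 * u) x) → (∀ t η, U t η = t * Z (Real.arccos (-(t / 2)) / Real.pi) η / (Z (Real.arccos (-(t / 2)) / Real.pi) (1 - η) + t * Z (Real.arccos (-(t / 2)) / Real.pi) η)) → (∀ (R : Literature.Probability.RandomPlanarGeometry.ConformalRectangle) (t δ : ℝ), uJ R t δ = if h : 0 < δ then (@Literature.Probability.LatticeModels.fkDomainMeasure R.carrier δ (t / (1 + t)) (t ^ 2) (R.arc 0 ∪ R.arc 2) (Literature.Probability.LatticeModels.meshDomain_finite R.isBounded h).fintype).real (Literature.Probability.Percolation.discreteCrossing R.carrier δ (R.arc 0) (R.arc 2)) else 0) → ∀ R : Literature.Probability.RandomPlanarGeometry.ConformalRectangle, ∃ a b : ℝ, 0 < a ∧ a < b ∧ b ≤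 1 ∧ ∀ t ∈ Set.Ioo a b, R.HasCrossingLimit (fun δ => uJ R t δ) (U t)) → Summit.CriticalPhenomena.CardyFormulaZ2.Theses.CardyUSTContinuation.SmallFugacityLimit := by
  intro hA hW
  have hC := continuumFamily_proof
  unfold ContinuumFamily at hC
  unfold UniformAnalyticExtension at hA
  unfold SmallFugacityLimit
  intro Z U uJ R
  obtain ⟨a, b, ha, hab, hb, hWR⟩ :=
    hW Z U uJ (fun _ _ => rfl) (fun _ _ => rfl) (fun _ _ _ => rfl) R
  refine ⟨1, one_pos, fun t ht => ?_⟩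
  exact hasCrossingLimit_of_window _ _ R (hA R) hC.2 ha hab hb hWR t ⟨ht.1, ht.2.le⟩

end Summit.CriticalPhenomena.CardyFormulaZ2.Cruxes.Target.CardyUSTContinuationBirth
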